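import Mathlib
import Summits.MatrixMultiplication.MatrixMultiplication.Theorems.SnSubsetDichotomyPolynomialSlackTwoPointFibring

/-!
# Two-point hub fibring with position blocks for TPP triples in `S_n`

Crux `Summit.MatrixMultiplication.MatrixMultiplication.Theses.SnSubsetDichotomy.PolynomialSlack`
(item `stmt-MatrixMultiplication-8306`), line `transport-split-hull`, two-point infrastructure: the
"2-hub" version of the two-point fibring cap `commonValues_two_volume_le`. For a TPP triple
`(S, T, U)` of `S_n`, two values `v ≠ v'`, position blocks `I, I', J, J' ⊆ Fin n` and positions
`k, k'`, the sub-triple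
`S₂ = {s ∈ S : s⁻¹ v ∈ I, s⁻¹ v' ∈ I'}`, `T₂ = {t ∈ T : t⁻¹ v ∈ J, t⁻¹ v' ∈ J'}`,
`U₂ = {u ∈ U : u k = v, u k' = v'}` is again TPP and fibres over the two-point stabiliser
`Stab(v) ⊓ Stab(v') ≅ S_{n-2}` via the label map `x ↦ (x⁻¹ v, x⁻¹ v')`
(`tpp_card_mul_mul_le_twoPointFibres`); the three label images have at most `|I| |I'|`, `|J| |J'|`
and `1` elements, whence `|S₂| |T₂| |U₂| ≤ |I| |I'| · |J| |J'| · B` for every bound `B` on TPP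
volumes in `S_{n-2}`.
-/

namespace Summit.MatrixMultiplication.MatrixMultiplication.Theorems.PolynomialSlack

open scoped BigOperators
open Literature.Combinatorics.Additive (TripleProductProperty)

set_option linter.dupNamespace false

/-- The label image of a block-restricted set `{x ∈ X : x⁻¹ v ∈ I ∧ x⁻¹ v' ∈ I'}` under
`x ↦ (x⁻¹ v, x⁻¹ v')` lies in `I ×ˢ I'`, so it has at most `|I| · |I'|` elements. [folklore] -/
theorem twoPointHub_card_image_inv_apply_filter_mem_le {n : ℕ} (X : Finset (Equiv.Perm (Fin n)))
    (v v' : Fin n) (I I' : Finset (Fin n)) :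
    ((X.filter fun x => x⁻¹ v ∈ I ∧ x⁻¹ v' ∈ I').image fun x => (x⁻¹ v, x⁻¹ v')).card ≤
      I.card * I'.card := by
  rw [← Finset.card_product]
  refine Finset.card_le_card ?_
  intro a ha
  simp only [Finset.mem_image, Finset.mem_filter] at ha
  obtain ⟨x, ⟨-, hx₁, hx₂⟩, rfl⟩ := ha
  exact Finset.mem_product.2 ⟨hx₁, hx₂⟩

/-- **Two-point hub fibring with position blocks.** If `B` bounds the volume `|S'||T'||U'|` of every
TPP triple of `S_{n-2}`, then for every TPP triple `(S, T, U)` of `S_n`, all values `v ≠ v'`, all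
position blocks `I, I', J, J'` and all positions `k, k'`:
`|{s ∈ S : s⁻¹ v ∈ I, s⁻¹ v' ∈ I'}| · |{t ∈ T : t⁻¹ v ∈ J, t⁻¹ v' ∈ J'}| ·
|{u ∈ U : u k = v, u k' = v'}| ≤ |I| |I'| · (|J| |J'|) · B` — two-point fibring over
`Stab(v) ⊓ Stab(v')` (`tpp_card_mul_mul_le_twoPointFibres`) applied to the sub-triple (TPP by
`TripleProductProperty.mono`), whose label images under `x ↦ (x⁻¹ v, x⁻¹ v')` lie in `I ×ˢ I'`,
`J ×ˢ J'` and `{(k, k')}` respectively. [folklore] -/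
theorem twoPoint_hub_fibring {n : ℕ} {v v' : Fin n} (hv : v ≠ v') (B : ℕ)
    (hB : ∀ S' T' U' : Finset (Equiv.Perm (Fin (n - 2))), TripleProductProperty S' T' U' →
      S'.card * T'.card * U'.card ≤ B)
    {S T U : Finset (Equiv.Perm (Fin n))} (h : TripleProductProperty S T U)
    (I I' J J' : Finset (Fin n)) (k k' : Fin n) :
    (S.filter fun s => s⁻¹ v ∈ I ∧ s⁻¹ v' ∈ I').card *
        (T.filter fun t => t⁻¹ v ∈ J ∧ t⁻¹ v' ∈ J').card *
        (U.filter fun u => u k = v ∧ u k' = v').card ≤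
      I.card * I'.card * (J.card * J'.card) * B := by
  have hsub : TripleProductProperty (S.filter fun s => s⁻¹ v ∈ I ∧ s⁻¹ v' ∈ I')
      (T.filter fun t => t⁻¹ v ∈ J ∧ t⁻¹ v' ∈ J') (U.filter fun u => u k = v ∧ u k' = v') :=
    h.mono (Finset.filter_subset _ _) (Finset.filter_subset _ _) (Finset.filter_subset _ _)
  have hS := twoPointHub_card_image_inv_apply_filter_mem_le S v v' I I'
  have hT := twoPointHub_card_image_inv_apply_filter_mem_le T v v' J J'
  have hU := card_image_inv_apply_two_filter_le_one U k k' v v'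
  calc (S.filter fun s => s⁻¹ v ∈ I ∧ s⁻¹ v' ∈ I').card *
        (T.filter fun t => t⁻¹ v ∈ J ∧ t⁻¹ v' ∈ J').card *
        (U.filter fun u => u k = v ∧ u k' = v').card
      ≤ ((S.filter fun s => s⁻¹ v ∈ I ∧ s⁻¹ v' ∈ I').image fun x => (x⁻¹ v, x⁻¹ v')).card *
          ((T.filter fun t => t⁻¹ v ∈ J ∧ t⁻¹ v' ∈ J').image fun x => (x⁻¹ v, x⁻¹ v')).card *
          ((U.filter fun u => u k = v ∧ u k' = v').image fun x => (x⁻¹ v, x⁻¹ v')).card * B :=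
        tpp_card_mul_mul_le_twoPointFibres hv B hB hsub
    _ ≤ I.card * I'.card * (J.card * J'.card) * 1 * B :=
        Nat.mul_le_mul (Nat.mul_le_mul (Nat.mul_le_mul hS hT) hU) le_rfl
    _ = I.card * I'.card * (J.card * J'.card) * B := by rw [Nat.mul_one]

end Summit.MatrixMultiplication.MatrixMultiplication.Theorems.PolynomialSlack
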